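import Literature.AlgebraicGeometry.AbelianSchemes.AbelianSchemeOverHomOfReduced
import Literature.AlgebraicGeometry.Morphisms.RigidityLemma
import HarnessLib

/-!
# The rigidity lemma for abelian schemes; morphisms agreeing on one fibre — [MumfordFogartyKirwan1994, Ch. 6 §1,
# Prop. 6.1 and Cor. 6.2] over a connected base (reduced total space)

[MumfordFogartyKirwan1994, Ch. 6 §1, pp. 115–117]: Prop. 6.1 (Rigidity lemma) — for `p : X → S` proper flat with
`H⁰(X_s, 𝒪_{X_s}) = κ(s)`, a section, `S` connected: an `S`-morphism `f : X → Y` contracting ONE fibre factors through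
the base; Cor. 6.2 — two `S`-morphisms `f, g : X → G` to a group scheme which agree on ONE fibre differ by a section:
`f = (η ∘ p) · g`.  THIS FILE specialises the tree's reduced-total-space rigidity lemma ★ `Morphisms.rigidity`
(`Literature/AlgebraicGeometry/Morphisms/RigidityLemma.lean`) to ABELIAN SCHEMES `A/S` (`AbelianSchemeOver`): the
hypotheses of Prop. 6.1 hold for `p = (A.X).hom` — proper (universally closed), smooth (flat and locally of finite
presentation, hence universally open), `H⁰(A_s, 𝒪) = κ(s)` (★ `surjective_appTop_fiberToSpecResidueField`), unit
section `ε = η` — so that, whenever the total space of `A` is reduced (e.g. over a reduced locally Noetherian base,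
★ `isReduced_left`) and `S` is preconnected:
* `rigidity` / `rigidity_of_isReduced_base` — Prop. 6.1: an `S`-morphism `A → Y` (`Y/S` separated) contracting one
  fibre is `toUnit ≫ η ≫ f`;
* `eq_section_mul_of_pullback_fst_comp_eq` / `eq_section_mul_of_fiberι_comp_eq` — Cor. 6.2: `f, g : A → G`
  (`G/S` a separated group scheme) agreeing on one geometric fibre `A ×_S Spec K ↪ A` (resp. scheme-theoretic fibre
  `A_{s₀} ↪ A`) satisfy `f = (toUnit ≫ η_A ≫ f·g⁻¹) · g`;
* `hom_eq_of_pullback_fst_comp_eq` / `hom_eq_of_pullback_map_eq` / `hom_eq_of_fiberι_comp_eq` /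
  `hom_eq_of_pullback_fst_comp_eq_of_isReduced_base` — RIGIDITY OF HOMOMORPHISMS: two homomorphisms `A → G` of
  `S`-group schemes agreeing on one (geometric) fibre are equal (restriction `Hom_S(A, G) → Hom_K(A_t, G_t)` is
  injective over a connected base) — the form used for level structures / Serre's lemma over a base
  ([MumfordFogartyKirwan1994] Ch. 7 §2, remark after Thm. 7.9).

Theorems only; no instance.  Cell hodgecm-mathlib, seat B-p18 (g13); `B-plan/M1PRIME-DAG.md` §3 N0/N4.  HC_CM is proved
only modulo the 7 printed citations until rung 0 closes; this file discharges none of them.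

## References
* [MumfordFogartyKirwan1994] D. Mumford, J. Fogarty, F. Kirwan, *Geometric Invariant Theory*, 3rd ed. (1994), Ch. 6 §1:
  Prop. 6.1 (pp. 115–116), Cor. 6.2 (p. 117); Ch. 7 §2 (level structures, the «lemma of Serre» remark after Thm. 7.9).
* [MumfordAV1970] D. Mumford, *Abelian Varieties*, §4 (rigidity lemma and corollaries).
-/

noncomputable section

universe u

open CategoryTheory CategoryTheory.Limits AlgebraicGeometry MonoidalCategory CartesianMonoidalCategory
open scoped MonObj

namespace Literature.AlgebraicGeometry.AbelianSchemes

namespace AbelianSchemeOver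

variable {S : Scheme.{u}} (A : AbelianSchemeOver S)

/-- The structure morphism of an abelian scheme is universally open (smooth ⇒ flat and locally of finite
presentation ⇒ universally open, Mathlib `UniversallyOpen.of_flat`). [cite: MumfordFogartyKirwan1994, Ch. 6 §1 Proposition 6.1 (pp. 115–116), proof («p is flat, hence open»)] -/
theorem universallyOpen_hom : UniversallyOpen A.X.hom := by
  haveI := A.isSmooth
  infer_instance

/-- The structure morphism of an abelian scheme is universally closed (it is proper).
[cite: MumfordFogartyKirwan1994, Ch. 6 §1 Definition 6.1 (p. 115)] -/
theorem universallyClosed_hom : UniversallyClosed A.X.hom := by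
  haveI := A.isProper
  infer_instance

/-- The unit section is a section: `η ≫ p = 𝟙 S` on underlying schemes. [cite: MumfordFogartyKirwan1994, Ch. 6 §1 (p. 115)] -/
theorem unit_left_comp_hom : (η[A.X]).left ≫ A.X.hom = 𝟙 S := by
  rw [Over.w]
  rfl

/-- **RIGIDITY LEMMA FOR ABELIAN SCHEMES** ([MumfordFogartyKirwan1994] Prop. 6.1): let `A/S` be an abelian scheme with
reduced total space over a preconnected base, `Y/S` separated, and `f : A → Y` an `S`-morphism mapping the fibre over
ONE point `s₀` to a single point.  Then `f` factors through the base: `f = toUnit ≫ η ≫ f` (`f` is the constant section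
`f ∘ ε` composed with the structure map). [cite: MumfordFogartyKirwan1994, Ch. 6 §1 Proposition 6.1 (Rigidity lemma) (pp. 115–116)] -/
theorem rigidity [IsReduced A.X.left] [PreconnectedSpace S] {Y : Over S} [IsSeparated Y.hom] (f : A.X ⟶ Y)
    {s₀ : S} {y₀ : Y.left} (h₀ : ∀ x : A.X.left, A.X.hom.base x = s₀ → f.left.base x = y₀) :
    f = toUnit A.X ≫ η[A.X] ≫ f := by
  haveI := A.universallyOpen_hom
  haveI := A.universallyClosed_hom
  ext : 1
  rw [Over.comp_left, Over.comp_left, Over.toUnit_left]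
  exact Literature.AlgebraicGeometry.Morphisms.rigidity f.left (Over.w f) (η[A.X]).left A.unit_left_comp_hom
    A.surjective_appTop_fiberToSpecResidueField h₀

/-- **Rigidity lemma for abelian schemes over a reduced locally Noetherian preconnected base** (total space then
reduced, ★ `isReduced_left`). [cite: MumfordFogartyKirwan1994, Ch. 6 §1 Proposition 6.1 (Rigidity lemma) (pp. 115–116)] -/
theorem rigidity_of_isReduced_base [IsReduced S] [IsLocallyNoetherian S] [PreconnectedSpace S] {Y : Over S}
    [IsSeparated Y.hom] (f : A.X ⟶ Y) {s₀ : S} {y₀ : Y.left}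
    (h₀ : ∀ x : A.X.left, A.X.hom.base x = s₀ → f.left.base x = y₀) :
    f = toUnit A.X ≫ η[A.X] ≫ f := by
  haveI := A.isReduced_left
  exact A.rigidity f h₀

/-- **[MumfordFogartyKirwan1994] Cor. 6.2** (reduced total space), at a FIELD-VALUED point: let `G/S` be a separated
`S`-group scheme and `f, g : A → G` two `S`-morphisms from an abelian scheme with reduced total space over a
preconnected base which AGREE ON THE GEOMETRIC FIBRE `A ×_S Spec K → A` over some field-valued point
`t : Spec K → S`.  Then `f = (η' ∘ p) · g` for the section `η' = η_A ≫ f·g⁻¹` of `G` — rigidity applied to `f · g⁻¹`,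
which contracts the fibre over the image point of `t` to the unit. [cite: MumfordFogartyKirwan1994, Ch. 6 §1 Corollary 6.2 (p. 117)] -/
theorem eq_section_mul_of_pullback_fst_comp_eq [IsReduced A.X.left] [PreconnectedSpace S] {G : Over S} [GrpObj G]
    [IsSeparated G.hom] (f g : A.X ⟶ G) {K : Type u} [Field K] (t : Spec (.of K) ⟶ S)
    (h : pullback.fst A.X.hom t ≫ f.left = pullback.fst A.X.hom t ≫ g.left) :
    f = (toUnit A.X ≫ η[A.X] ≫ (f * g⁻¹)) * g := by
  -- the geometric fibre as an `S`-scheme over `A`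
  let j : Over.mk (pullback.fst A.X.hom t ≫ A.X.hom) ⟶ A.X := Over.homMk (pullback.fst A.X.hom t) rfl
  have hj : j ≫ f = j ≫ g := by
    ext : 1
    exact h
  have hq : j ≫ (f * g⁻¹) = toUnit _ ≫ η[G] := by
    rw [MonObj.comp_mul, GrpObj.comp_inv, hj, mul_inv_cancel, Hom.one_def]
  -- `f · g⁻¹` contracts the fibre over the image point `s₀` of `t` to the unit point `η_G(s₀)`
  let s₀ : S := t.base (IsLocalRing.closedPoint K)
  have h₀ : ∀ x : A.X.left, A.X.hom.base x = s₀ → (f * g⁻¹).left.base x = (η[G]).left.base s₀ := by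
    intro x hx
    obtain ⟨x', rfl⟩ : x ∈ Set.range (pullback.fst A.X.hom t).base := by
      rw [Scheme.Pullback.range_fst]
      exact ⟨IsLocalRing.closedPoint K, hx.symm⟩
    have hx' : A.X.hom.base ((pullback.fst A.X.hom t).base x') = s₀ := hx
    have := congrArg (fun φ : Over.mk (pullback.fst A.X.hom t ≫ A.X.hom) ⟶ G => φ.left.base x') hq
    simp only [Over.comp_left, Scheme.Hom.comp_base, TopCat.comp_app, Over.toUnit_left] at this
    change (f * g⁻¹).left.base ((pullback.fst A.X.hom t).base x') =
      (η[G]).left.base ((pullback.fst A.X.hom t ≫ A.X.hom).base x') at this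
    rw [this, Scheme.Hom.comp_apply, hx']
  conv_lhs => rw [← inv_mul_cancel_right f g, ← div_eq_mul_inv]
  rw [div_eq_mul_inv, ← A.rigidity (f * g⁻¹) h₀]

/-- **[MumfordFogartyKirwan1994] Cor. 6.2** at a scheme-theoretic fibre `A_{s₀} ↪ A` (`Scheme.Hom.fiberι`): `f, g`
agreeing on one fibre satisfy `f = (toUnit ≫ η_A ≫ f·g⁻¹) · g`. [cite: MumfordFogartyKirwan1994, Ch. 6 §1 Corollary 6.2 (p. 117)] -/
theorem eq_section_mul_of_fiberι_comp_eq [IsReduced A.X.left] [PreconnectedSpace S] {G : Over S} [GrpObj G]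
    [IsSeparated G.hom] (f g : A.X ⟶ G) (s₀ : S)
    (h : A.X.hom.fiberι s₀ ≫ f.left = A.X.hom.fiberι s₀ ≫ g.left) :
    f = (toUnit A.X ≫ η[A.X] ≫ (f * g⁻¹)) * g :=
  A.eq_section_mul_of_pullback_fst_comp_eq f g (K := S.residueField s₀) (S.fromSpecResidueField s₀) h

/-- **RIGIDITY OF HOMOMORPHISMS** (from [MumfordFogartyKirwan1994] Cor. 6.2): two HOMOMORPHISMS `f, g : A → G` of
`S`-group schemes from an abelian scheme with reduced total space over a preconnected base to a separated group scheme
which agree on ONE geometric fibre `A ×_S Spec K` (field-valued point `t : Spec K → S`) are EQUAL — by Cor. 6.2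
`f = (η' ∘ p) · g` with `η' = η_A ≫ f·g⁻¹ = η_G · η_G⁻¹ = 1`.  (So `Hom_S(A, G) → Hom_K(A_t, G_t)` is injective over a
connected base: the form behind level-structure rigidity / Serre's lemma over a base.)
[cite: MumfordFogartyKirwan1994, Ch. 6 §1 Corollary 6.2 (p. 117)] -/
theorem hom_eq_of_pullback_fst_comp_eq [IsReduced A.X.left] [PreconnectedSpace S] {G : Over S} [GrpObj G]
    [IsSeparated G.hom] (f g : A.X ⟶ G) [IsMonHom f] [IsMonHom g] {K : Type u} [Field K]
    (t : Spec (.of K) ⟶ S) (h : pullback.fst A.X.hom t ≫ f.left = pullback.fst A.X.hom t ≫ g.left) : f = g := by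
  have key := A.eq_section_mul_of_pullback_fst_comp_eq f g t h
  have hη : η[A.X] ≫ (f * g⁻¹) = 1 := by
    rw [MonObj.comp_mul, GrpObj.comp_inv, IsMonHom.one_hom, IsMonHom.one_hom, mul_inv_cancel]
  rw [hη, MonObj.comp_one, one_mul] at key
  exact key

/-- **Base-change form**: two homomorphisms `A → G` whose base changes to some field-valued point `t : Spec K → S`
coincide, `(Over.pullback t).map f = (Over.pullback t).map g`, are equal (reduced total space, preconnected base,
`G/S` separated). [cite: MumfordFogartyKirwan1994, Ch. 6 §1 Corollary 6.2 (p. 117)] -/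
theorem hom_eq_of_pullback_map_eq [IsReduced A.X.left] [PreconnectedSpace S] {G : Over S} [GrpObj G]
    [IsSeparated G.hom] (f g : A.X ⟶ G) [IsMonHom f] [IsMonHom g] {K : Type u} [Field K]
    (t : Spec (.of K) ⟶ S) (h : (Over.pullback t).map f = (Over.pullback t).map g) : f = g := by
  refine A.hom_eq_of_pullback_fst_comp_eq f g t ?_
  have hf : ((Over.pullback t).map f).left ≫ pullback.fst G.hom t = pullback.fst A.X.hom t ≫ f.left := by
    simp only [Over.pullback_map_left]
    erw [pullback.lift_fst]
  have hg : ((Over.pullback t).map g).left ≫ pullback.fst G.hom t = pullback.fst A.X.hom t ≫ g.left := by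
    simp only [Over.pullback_map_left]
    erw [pullback.lift_fst]
  rw [← hf, ← hg, h]

/-- **Rigidity of homomorphisms at a scheme-theoretic fibre**: homomorphisms `f, g : A → G` agreeing on `A_{s₀} ↪ A`
coincide. [cite: MumfordFogartyKirwan1994, Ch. 6 §1 Corollary 6.2 (p. 117)] -/
theorem hom_eq_of_fiberι_comp_eq [IsReduced A.X.left] [PreconnectedSpace S] {G : Over S} [GrpObj G]
    [IsSeparated G.hom] (f g : A.X ⟶ G) [IsMonHom f] [IsMonHom g] (s₀ : S)
    (h : A.X.hom.fiberι s₀ ≫ f.left = A.X.hom.fiberι s₀ ≫ g.left) : f = g :=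
  A.hom_eq_of_pullback_fst_comp_eq f g (K := S.residueField s₀) (S.fromSpecResidueField s₀) h

/-- **Rigidity of homomorphisms over a reduced locally Noetherian preconnected base**: two homomorphisms from an abelian
scheme to a separated `S`-group scheme agreeing on one geometric fibre coincide. [cite: MumfordFogartyKirwan1994, Ch. 6 §1 Corollary 6.2 (p. 117)] -/
theorem hom_eq_of_pullback_fst_comp_eq_of_isReduced_base [IsReduced S] [IsLocallyNoetherian S] [PreconnectedSpace S]
    {G : Over S} [GrpObj G] [IsSeparated G.hom] (f g : A.X ⟶ G) [IsMonHom f] [IsMonHom g] {K : Type u} [Field K]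
    (t : Spec (.of K) ⟶ S) (h : pullback.fst A.X.hom t ≫ f.left = pullback.fst A.X.hom t ≫ g.left) : f = g := by
  haveI := A.isReduced_left
  exact A.hom_eq_of_pullback_fst_comp_eq f g t h

end AbelianSchemeOver

end Literature.AlgebraicGeometry.AbelianSchemes

end
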